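import Summits.KontsevichZagierPeriods.KontsevichZagierPeriods.Theses.BoundaryLevel
import Summits.KontsevichZagierPeriods.KontsevichZagierPeriods.Theorems.SymplecticScissorsVolumeFormOffPlaneSplit
import Summits.KontsevichZagierPeriods.KontsevichZagierPeriods.Theorems.SymplecticScissorsVolumeFormOffPlaneDimLeOne

/-!
# `CubicSkinComplement` (stmt-KontsevichZagierPeriods-14225, route BoundaryLevel, auto-crux rank 9) — line `birth`, LEAD-OWNED skeleton

Lead: prover-line-stmt-KontsevichZagierPeriods-14225-c1-0 (continuation c1, picked 2026-08-17,
`Cruxes/CubicSkinComplement/PICKED.md`; first lead prover-line-stmt-KontsevichZagierPeriods-14225-0).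
Lead's reshape v1 (kept by c1): stubs UNCHANGED (byte-identical with items 18392 / 3574 so that one
proof closes each everywhere); `cubicSkinComplement_of_volumeForm` (the crux ⟸ item 3814 verbatim,
one line) records in the skeleton what the census says in words: modulo the sector crux
`CubicSkinScissors` (11388) this crux IS the frame `VolumeForm` (3814). The sorry-free glue of this
file is landed under `Theorems/BoundaryLevelCubicSkinComplementSplit.lean` (`--supports` 14225).

Crux (the route's declared SECTOR COMPLEMENT, summit-strength, "NOT CLAIMED"; route-choice repair
2026-08-16, auto-crux backfill): `CubicSkinComplement := CubicSkinScissors → VolumeForm` — GIVEN the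
level-one solid sector (two bounded solids in `ℝ³` with frontier on smooth cubic skins transverse to
infinity and equal volume are KZ-equivalent), the whole frame `VolumeForm` (stmt-3814: two
integrand-`1` representations of one dimension `N` with equal value are KZ-equivalent). Modulo the
proved shared Assembly stmt-3822 (`VolumeForm → KontsevichZagierPeriods`) and the planner's proved
converse (`KontsevichZagierPeriods → VolumeForm`, integrand `1` is KZ-rational), the crux is
`CubicSkinScissors → Conjecture 1` (refuter g48-2 / grounder g49-7 read-backs on the item).

## Why the sector hypothesis is not consumed
`CubicSkinScissors` is an INSTANCE of the conclusion `VolumeForm` (its `N = 3` cubic-skin pairs), so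
no proof of `VolumeForm` can be shortened by it except on its own sector; and the frame does not split
as "sector ∨ complement": a pair (cubic-skin solid `r`, arbitrary solid `r'` of the same volume)
STRADDLES the sector, and any engine that makes `r ∼ r'` must already digest the cubic-skin solid `r`
itself. A "normal form onto cubic skins" that would let the sector hypothesis act is FALSE in kind
(the solid torus `{(√(x²+y²) − R)² + z² < ρ²}` is a bounded `ℚ`-solid of volume `2π²Rρ²`, a weight-4
period, while cubic-skin volumes are `2πi ×` 1-periods by the route's own value crux
`CubicSkinVolumes`). Hence an honest skeleton of the complement is a skeleton of the frame, and the
binder `hS` is discharged vacuously in `CubicSkinComplement_of` — recorded, not hidden: the two stubs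
even RE-PROVE the sector crux (`cubicSkinScissors_of_stubs`).

## The line: Ayoub's normal-form seam (A) ∧ (G), both stubs SHARED byte-for-byte with filed items
* `stub_typeAGeneration` = (A) the ARITHMETIC piece, verbatim the body of item
  stmt-KontsevichZagierPeriods-18392 `SymplecticScissors.TypeAGeneration` = the tree's conjecture leaf
  `TypeAGenerationConjecture` (`Theorems/TypeAGenerationConjecture.lean`, `Iff.rfl`): Ayoub, Ann. of
  Math. 181 (2015) Conj. 1.1 / Fresán 2024 Conj. 3.5 — on `𝒪_{k-alg}(𝔻̄^∞)` the kernel of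
  `∫_{[0,1]^∞}` is the `k`-span of the Stokes elements `∂G/∂zᵢ − G|_{zᵢ=1} + G|_{zᵢ=0}`. OPEN,
  period-conjecture strength: this is where the crux's conjecture-grade content lives. It constrains
  VALUES of cube integrals only — no domains, no moves.
* `stub_cubeNashNormalForm` = (G) the GEOMETRIC piece, verbatim the body of item
  stmt-KontsevichZagierPeriods-3574 `LiftingCriteria.CubeNashNormalForm` (= `SymplecticScissors.…`,
  `DimensionBudget.…`, `Iff.rfl`): every difference of KZ-rational representations is, INSIDE THE
  MOVES, a `ℤ`-combination of closed-cube representations with `ℚ`-semialgebraic integrands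
  real-analytic near the closed cube. Theorem-grade (XL; embedded resolution over `ℝ` realised by
  rules 1a + 2), transcendence-free; it constrains no value. Landed partial results:
  `LiftingCriteria.CubeNashNormalFormReduction.cubeNashNormalForm_of_volume` (it suffices to treat
  bounded integrand-`1` solids), `…DimLeOne`, `…VolumeTwo` (the line and the plane are done).
One proof of either stub closes it here AND on routes SymplecticScissors (18392 / 3574, split glue
18438 landed), LiftingCriteria (3574), SphericalSchlafli (`CubeResolution` 17978 ⟸ 3574;
`AyoubEffectiveCubeKernel` 18116 ⟺ 18392 by `typeAGenerationConjecture_iff_fresan`), UnfoldedStokes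
(`StokesGeneration` 3586 line `Sketch`), FurushoPentagon (10813 S1/S6) and CommonUnfolding
(`UnfoldingComplement` 14445 birth).

## Composition (sorry-free, a construction — not a seam)
`volumeForm_of_stubs`: for integrand-`1` `r r'` of one dimension with `r.value = r'.value`, (G) puts
`[r] − [r'] ≡ Σ εᵢ[sᵢ]` (cube–Nash) inside the moves (integrand-`1` representations are KZ-rational,
`isRational_of_integrand_one`); soundness of the calculus (`KZ.relations_le_ker_eval_holds`) turns
`value r = value r'` into `eval (Σ εᵢ[sᵢ]) = 0`; the LANDED Ayoub compiler
`StokesGenerationLine.sum_cubeNash_mem_relations_of_typeAGenerationConjecture` (merge cubes → Nash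
germ → element of `𝒪_{ℚ̄-alg}(𝔻̄^∞)` → (A) → type-(a) elements → instances of the four moves, all
landed, `Theorems/UnfoldedStokesStokesGenerationLineReduction{,Named}.lean`) driven by (A) makes that
combination a relation; the two differences telescope. This is, inlined, the landed
`SymplecticScissors.OffPlaneSplit.volumeForm_of_subs` (`Theorems/SymplecticScissorsVolumeFormOffPlaneSplit.lean`,
p-landed @ cdb51fd40340), re-run against THIS route's copy of the frame (`volumeForm_iff_symplecticScissors :
BoundaryLevel.VolumeForm ↔ SymplecticScissors.VolumeForm := Iff.rfl` records that the two copies of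
stmt-3814 are one statement). `CubicSkinComplement_of : (A) → (G) → CubicSkinComplement` — with (A), (G) written BY NAME as
the registered obligations the stubs are shared with, `SymplecticScissors.TypeAGeneration` (18392) and
`LiftingCriteria.CubeNashNormalForm` (3574), each definitionally the literal stub statement
(`stubs_iff_items`, `Iff.rfl`) — then discards `hS` (see above) and concludes the crux BY NAME;
`CubicSkinComplement_of_stubs` feeds it the two `stub_*` theorems on the nose.

Strength bookkeeping (no converse claimed): (A) ∧ (G) ⇒ frame ⇒ summit
(`kontsevichZagierPeriods_of_typeAGenerationConjecture`, landed, needs BOTH); (A) alone reaches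
dimension `≤ 1` and cube–Nash combinations only; (G) alone reaches no value; neither piece is
tree-comparable with the crux, the frame or the Statement (probe record `Lines/birth.md`; the sibling
record `Cruxes/VolumeForm/SplitProbes.md` has 18/18 failures for the same two pieces against
`SphericalSchlafli.VolumeForm` and the Statement).

Disproof used: none on file — `ledger crux ls stmt-KontsevichZagierPeriods-14225`: no workfiles (no
`Disproof.lean`, no ideas, no dead lines) before this one; `ledger negatives --problem
KontsevichZagierPeriods`: one unrelated entry (stmt-5394, plane convexity / KinematicFormulas). Barriers:
the catalogued strength barriers (`kzConjecture_implies_oddZetaAlgIndep`, `_twoPiI_log_algIndep`,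
`_ellipticPeriods_algIndep`) bite on (A) exactly as on the crux (conceded: (A) is the transcendence
leaf, conjecture-grade by design); (G) is transcendence-free and outside their class;
`noSemialgebraicPrimitive_inv_sub_two` is not engaged (the only rule-(3) primitives in the compiler
are algebraic AND analytic, `stub_semialgebraicOfAlgebraic` landed); `cressonViuSos_prop_3_2` not
engaged (no global transport map). All statements are over existing declarations only.

References: M. Kontsevich, D. Zagier, *Periods* (2001), §1.2 Conjecture 1; J. Ayoub, Ann. of Math.
181 (2015), Conj. 1.1, Fait 1.4; J. Fresán, *Une introduction aux périodes* (2024), Conj. 3.5;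
A. Huber, S. Müller-Stach, *Periods and Nori motives* (2017), Thm. 12.2.1; H. Hironaka (1964) /
E. Bierstone, P. Milman (1988) §4; J. Viu-Sos, *A semi-canonical reduction for periods of
Kontsevich–Zagier* (2021), Thm. 1.1.
-/

noncomputable section

set_option linter.dupNamespace false

namespace Summit.KontsevichZagierPeriods.KontsevichZagierPeriods.Cruxes.CubicSkinComplement.Birth

open Set MeasureTheory
open Literature.NumberTheory.Transcendental
open Literature.NumberTheory.Transcendental.KZ
open Summit.KontsevichZagierPeriods.KontsevichZagierPeriods (TypeAGenerationConjecture)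
open Summit.KontsevichZagierPeriods.KontsevichZagierPeriods.Theses.BoundaryLevel
  (VolumeForm CubicSkinScissors CubicSkinComplement)
open Summit.KontsevichZagierPeriods.KontsevichZagierPeriods.StokesGenerationLine
  (sum_cubeNash_mem_relations_of_typeAGenerationConjecture)

/-! ## The two registered stubs -/

/-- **(A) — Ayoub's Conjecture 1.1 / Fresán's Conjecture 3.5 (type-(a) generation), verbatim item
stmt-KontsevichZagierPeriods-18392 and the conjecture leaf `TypeAGenerationConjecture`.** For every
field `k` of characteristic `0` and embedding `σ : k →+* ℂ` with algebraic image, every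
`F ∈ 𝒪_{k-alg}(𝔻̄^∞)` with `∫_{[0,1]^∞} F = 0` is a `k`-combination of Stokes elements
`∂G/∂zᵢ − G|_{zᵢ=1} + G|_{zᵢ=0}`. OPEN (period-conjecture strength; the conjecture-grade content of
the crux lives here). [Ayoub, Ann. of Math. 181 (2015), Conj. 1.1; Fresán 2024, Conj. 3.5] -/
theorem stub_typeAGeneration :
    ∀ (k : Type) [Field k] [CharZero k] (σ : k →+* ℂ), (∀ c : k, IsAlgebraic ℚ (σ c)) → ∀ F ∈ Literature.NumberTheory.Transcendental.AyoubRel.Oan σ, Literature.NumberTheory.Transcendental.AyoubRel.intC F = 0 → F ∈ Literature.NumberTheory.Transcendental.AyoubRel.kSpan σ {x : Literature.NumberTheory.Transcendental.AyoubRel.CSeries | ∃ G ∈ Literature.NumberTheory.Transcendental.AyoubRel.Oan σ, ∃ i : ℕ, x = Literature.NumberTheory.Transcendental.AyoubRel.relAC i G} := by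
  sorry

/-- **(G) — cube–Nash normal form by moves, verbatim item stmt-KontsevichZagierPeriods-3574
(`LiftingCriteria.CubeNashNormalForm`).** Every difference of KZ-rational representations is,
inside the four-move calculus, a `ℤ`-combination of closed-cube representations `∫_{[0,1]^{nᵢ}} gᵢ`
with `gᵢ` `ℚ`-semialgebraic and real-analytic on a neighbourhood of the closed cube. Theorem-grade,
transcendence-free, XL (embedded resolution over `ℝ` realised by rules 1a + 2; the open core is
bounded integrand-`1` solids of dimension `≥ 3`, by the landed reductions).
[Hironaka 1964; Bierstone–Milman 1988, §4; Huber–Müller-Stach 2017, Thm. 12.2.1; Viu-Sos 2021, Thm. 1.1] -/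
theorem stub_cubeNashNormalForm :
    ∀ (k k' : ℕ) (r : Literature.NumberTheory.Transcendental.KZ.IntegralRep k) (r' : Literature.NumberTheory.Transcendental.KZ.IntegralRep k'), r.IsRational → r'.IsRational → ∃ (S : ℕ) (n : Fin S → ℕ) (g : (i : Fin S) → (Fin (n i) → ℝ) → ℝ) (U : (i : Fin S) → Set (Fin (n i) → ℝ)) (ε : Fin S → ℤ) (s : (i : Fin S) → Literature.NumberTheory.Transcendental.KZ.IntegralRep (n i)), (∀ i, IsOpen (U i) ∧ Set.pi Set.univ (fun _ : Fin (n i) => Set.Icc (0:ℝ) 1) ⊆ (U i) ∧ Literature.NumberTheory.Transcendental.IsSemialgebraicFunOn ℚ (U i) (g i) ∧ AnalyticOnNhd ℝ (g i) (U i)) ∧ (∀ i, (s i).domain = Set.pi Set.univ (fun _ : Fin (n i) => Set.Icc (0:ℝ) 1) ∧ ∀ z ∈ Set.pi Set.univ (fun _ : Fin (n i) => Set.Icc (0:ℝ) 1), (s i).integrand z = g i z) ∧ Literature.NumberTheory.Transcendental.KZ.of r - Literature.NumberTheory.Transcendental.KZ.of r' - ∑ i, ε i • Literature.NumberTheory.Transcendental.KZ.of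 (s i) ∈ Literature.NumberTheory.Transcendental.KZ.relations := by
  sorry

/-! ## Glue (sorry-free) -/

/-- An integrand-`1` representation has the literal shape of Kontsevich–Zagier's Definition
(`p = q = 1`). [folklore] -/
theorem isRational_of_integrand_one {N : ℕ} (r : IntegralRep N)
    (hr : ∀ x ∈ r.domain, r.integrand x = 1) : r.IsRational :=
  ⟨1, 1, fun x _ => by simp, fun x hx => by simp [hr x hx]⟩

/-- This route's copy of the frame (item stmt-3814 on BoundaryLevel) and the sibling copy on
SymplecticScissors are one statement (definitional unfolding). [folklore] -/
theorem volumeForm_iff_symplecticScissors :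
    VolumeForm ↔
      Summit.KontsevichZagierPeriods.KontsevichZagierPeriods.Theses.SymplecticScissors.VolumeForm :=
  Iff.rfl

/-- **(A) ∧ (G) ⇒ the frame `VolumeForm`** (stmt-3814, every dimension `N`), the two stubs written
out as hypotheses: cube–Nash normal form of `[r] − [r']` by (G), value `0` by soundness, relation by
the landed Ayoub compiler driven by (A), telescoping. (Inlined twin of the landed
`SymplecticScissors.OffPlaneSplit.volumeForm_of_subs`.) [Kontsevich–Zagier 2001, §1.2 Conjecture 1;
Ayoub 2015, Conj. 1.1] -/
theorem volumeForm_of_stubs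
    (hT : ∀ (k : Type) [Field k] [CharZero k] (σ : k →+* ℂ), (∀ c : k, IsAlgebraic ℚ (σ c)) → ∀ F ∈ Literature.NumberTheory.Transcendental.AyoubRel.Oan σ, Literature.NumberTheory.Transcendental.AyoubRel.intC F = 0 → F ∈ Literature.NumberTheory.Transcendental.AyoubRel.kSpan σ {x : Literature.NumberTheory.Transcendental.AyoubRel.CSeries | ∃ G ∈ Literature.NumberTheory.Transcendental.AyoubRel.Oan σ, ∃ i : ℕ, x = Literature.NumberTheory.Transcendental.AyoubRel.relAC i G})
    (hN : ∀ (k k' : ℕ) (r : Literature.NumberTheory.Transcendental.KZ.IntegralRep k) (r' : Literature.NumberTheory.Transcendental.KZ.IntegralRep k'), r.IsRational → r'.IsRational → ∃ (S : ℕ) (n : Fin S → ℕ) (g : (i : Fin S) → (Fin (n i) → ℝ) → ℝ) (U : (i : Fin S) → Set (Fin (n i) → ℝ)) (ε : Fin S → ℤ) (s : (i : Fin S) → Literature.NumberTheory.Transcendental.KZ.IntegralRep (n i)), (∀ i, IsOpen (U i) ∧ Set.pi Set.univ (fun _ : Fin (n i) => Set.Icc (0:ℝ) 1) ⊆ (U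 i) ∧ Literature.NumberTheory.Transcendental.IsSemialgebraicFunOn ℚ (U i) (g i) ∧ AnalyticOnNhd ℝ (g i) (U i)) ∧ (∀ i, (s i).domain = Set.pi Set.univ (fun _ : Fin (n i) => Set.Icc (0:ℝ) 1) ∧ ∀ z ∈ Set.pi Set.univ (fun _ : Fin (n i) => Set.Icc (0:ℝ) 1), (s i).integrand z = g i z) ∧ Literature.NumberTheory.Transcendental.KZ.of r - Literature.NumberTheory.Transcendental.KZ.of r' - ∑ i, ε i • Literature.NumberTheory.Transcendental.KZ.of (s i) ∈ Literature.NumberTheory.Transcendental.KZ.relations) :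
    VolumeForm := by
  classical
  intro N r r' hr hr' hv
  -- (A) is the conjecture leaf, by name
  have hT' : TypeAGenerationConjecture := hT
  -- (G): the cube–Nash normal form of `[r] − [r']` inside the moves
  obtain ⟨S, nS, g, U, ε, s, hNash, hs, hNF⟩ :=
    hN N N r r' (isRational_of_integrand_one r hr) (isRational_of_integrand_one r' hr')
  -- soundness: the normal form has value `0`
  have hsum0 : eval (∑ i, ε i • of (s i)) = 0 := by
    have h := relations_le_ker_eval_holds hNF
    rw [AddMonoidHom.mem_ker, map_sub, map_sub, eval_of, eval_of, hv, sub_self, zero_sub,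
      neg_eq_zero] at h
    exact h
  -- (A) + the landed compiler: a cube–Nash combination of value `0` is a relation
  have hsum : ∑ i, ε i • of (s i) ∈ relations :=
    sum_cubeNash_mem_relations_of_typeAGenerationConjecture hT' S nS g U ε s hNash hs hsum0
  -- telescope
  show of r - of r' ∈ relations
  have e : of r - of r' = (of r - of r' - ∑ i, ε i • of (s i)) + ∑ i, ε i • of (s i) := by abel
  rw [e]
  exact relations.add_mem hNF hsum

/-- Cross-check against the tree: the inlined glue agrees with the LANDED split glue of the sibling
route (`OffPlaneSplit.volumeForm_of_subs`), transported along `volumeForm_iff_symplecticScissors`.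
[Kontsevich–Zagier 2001, §1.2 Conjecture 1] -/
theorem volumeForm_of_stubs'
    (hT : ∀ (k : Type) [Field k] [CharZero k] (σ : k →+* ℂ), (∀ c : k, IsAlgebraic ℚ (σ c)) → ∀ F ∈ Literature.NumberTheory.Transcendental.AyoubRel.Oan σ, Literature.NumberTheory.Transcendental.AyoubRel.intC F = 0 → F ∈ Literature.NumberTheory.Transcendental.AyoubRel.kSpan σ {x : Literature.NumberTheory.Transcendental.AyoubRel.CSeries | ∃ G ∈ Literature.NumberTheory.Transcendental.AyoubRel.Oan σ, ∃ i : ℕ, x = Literature.NumberTheory.Transcendental.AyoubRel.relAC i G})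
    (hN : ∀ (k k' : ℕ) (r : Literature.NumberTheory.Transcendental.KZ.IntegralRep k) (r' : Literature.NumberTheory.Transcendental.KZ.IntegralRep k'), r.IsRational → r'.IsRational → ∃ (S : ℕ) (n : Fin S → ℕ) (g : (i : Fin S) → (Fin (n i) → ℝ) → ℝ) (U : (i : Fin S) → Set (Fin (n i) → ℝ)) (ε : Fin S → ℤ) (s : (i : Fin S) → Literature.NumberTheory.Transcendental.KZ.IntegralRep (n i)), (∀ i, IsOpen (U i) ∧ Set.pi Set.univ (fun _ : Fin (n i) => Set.Icc (0:ℝ) 1) ⊆ (U i) ∧ Literature.NumberTheory.Transcendental.IsSemialgebraicFunOn ℚ (U i) (g i) ∧ AnalyticOnNhd ℝ (g i) (U i)) ∧ (∀ i, (s i).domain = Set.pi Set.univ (fun _ : Fin (n i) => Set.Icc (0:ℝ) 1) ∧ ∀ z ∈ Set.pi Set.univ (fun _ : Fin (n i) => Set.Icc (0:ℝ) 1), (s i).integrand z = g i z) ∧ Literature.NumberTheory.Transcendental.KZ.of r - Literature.NumberTheory.Transcendental.KZ.of r' - ∑ i, ε i • Literature.NumberTheory.Transcendental.KZ.of (s i)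 ∈ Literature.NumberTheory.Transcendental.KZ.relations) :
    VolumeForm :=
  volumeForm_iff_symplecticScissors.mpr
    (Summit.KontsevichZagierPeriods.SymplecticScissors.OffPlaneSplit.volumeForm_of_subs hT hN)

/-- The sector hypothesis of the crux is SUBSUMED by the stubs: they re-prove the sector crux
`CubicSkinScissors` (stmt-11388) itself, as the `N = 3` cubic-skin instance of the frame. Recorded so
that the vacuous discharge of `hS` below is read as bookkeeping, not as an oversight.
[Kontsevich–Zagier 2001, §1.2 Conjecture 1] -/
theorem cubicSkinScissors_of_stubs
    (hT : ∀ (k : Type) [Field k] [CharZero k] (σ : k →+* ℂ), (∀ c : k, IsAlgebraic ℚ (σ c)) → ∀ F ∈ Literature.NumberTheory.Transcendental.AyoubRel.Oan σ, Literature.NumberTheory.Transcendental.AyoubRel.intC F = 0 → F ∈ Literature.NumberTheory.Transcendental.AyoubRel.kSpan σ {x : Literature.NumberTheory.Transcendental.AyoubRel.CSeries | ∃ G ∈ Literature.NumberTheory.Transcendental.AyoubRel.Oan σ, ∃ i : ℕ, x = Literature.NumberTheory.Transcendental.AyoubRel.relAC i G})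
    (hN : ∀ (k k' : ℕ) (r : Literature.NumberTheory.Transcendental.KZ.IntegralRep k) (r' : Literature.NumberTheory.Transcendental.KZ.IntegralRep k'), r.IsRational → r'.IsRational → ∃ (S : ℕ) (n : Fin S → ℕ) (g : (i : Fin S) → (Fin (n i) → ℝ) → ℝ) (U : (i : Fin S) → Set (Fin (n i) → ℝ)) (ε : Fin S → ℤ) (s : (i : Fin S) → Literature.NumberTheory.Transcendental.KZ.IntegralRep (n i)), (∀ i, IsOpen (U i) ∧ Set.pi Set.univ (fun _ : Fin (n i) => Set.Icc (0:ℝ) 1) ⊆ (U i) ∧ Literature.NumberTheory.Transcendental.IsSemialgebraicFunOn ℚ (U i) (g i) ∧ AnalyticOnNhd ℝ (g i) (U i)) ∧ (∀ i, (s i).domain = Set.pi Set.univ (fun _ : Fin (n i) => Set.Icc (0:ℝ) 1) ∧ ∀ z ∈ Set.pi Set.univ (fun _ : Fin (n i) => Set.Icc (0:ℝ) 1), (s i).integrand z = g i z) ∧ Literature.NumberTheory.Transcendental.KZ.of r - Literature.NumberTheory.Transcendental.KZ.of r' - ∑ i, ε i • Literature.NumberTheory.Transcendental.KZ.of (s i)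 ∈ Literature.NumberTheory.Transcendental.KZ.relations) :
    CubicSkinScissors := by
  intro F F' q₂ q₃ q₂' q₃' r r' _ _ _ _ _ _ _ hr _ _ _ _ _ _ _ _ _ hr' _ _ hv
  exact volumeForm_of_stubs hT hN r r' hr hr' hv

/-! ## A sorry-free special case (BC5): the crux in dimensions `≤ 1` -/

/-- **Special case, unconditional** (no stub): the crux restricted to dimensions `N ≤ 1` — the line
and the point. Finite unions of intervals with real-algebraic end points and equal total length are
KZ-equivalent by rule-1a cuts and rule-2 translations; landed as
`SymplecticScissors.LogPolytope.stub_dimLeOne` (`Theorems/SymplecticScissorsVolumeFormOffPlaneDimLeOne.lean`).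
Shows that the definitions compute and that the crux is inhabited in kind; the open content starts at
`N = 2` (PlanarAreas, stmt-4990) and is frame-strength from `N = 3` on. [Kontsevich–Zagier 2001, §1.2] -/
theorem cubicSkinComplement_dimLeOne :
    CubicSkinScissors → ∀ ⦃N : ℕ⦄, N ≤ 1 → ∀ (r r' : IntegralRep N),
      (∀ x ∈ r.domain, r.integrand x = 1) → (∀ x ∈ r'.domain, r'.integrand x = 1) →
      r.value = r'.value → Equivalent r r' :=
  fun _ N hN r r' hr hr' hv =>
    Summit.KontsevichZagierPeriods.SymplecticScissors.LogPolytope.stub_dimLeOne N hN r r' hr hr' hv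

/-! ## The crux -/

/-- **The crux from the frame, verbatim**: `VolumeForm` (item stmt-3814, here in the sibling
route's rendering `SymplecticScissors.VolumeForm`, definitionally this route's `VolumeForm`) gives
`CubicSkinComplement` by discarding the sector hypothesis. Together with the trivial converse under
`CubicSkinScissors` this is the exact strength of the crux: 14225 ∧ 11388 ⟺ 3814 ∧ 11388.
[Kontsevich–Zagier 2001, §1.2 Conjecture 1] -/
theorem cubicSkinComplement_of_volumeForm
    (hV : Summit.KontsevichZagierPeriods.KontsevichZagierPeriods.Theses.SymplecticScissors.VolumeForm) :
    CubicSkinComplement :=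
  fun _hS => volumeForm_iff_symplecticScissors.mpr hV

/-- The converse direction under the sector crux (modus ponens), recorded for the strength
bookkeeping only. [Kontsevich–Zagier 2001, §1.2 Conjecture 1] -/
theorem volumeForm_of_cubicSkinComplement (hS : CubicSkinScissors) (hC : CubicSkinComplement) :
    VolumeForm :=
  hC hS


/-- **Skeleton theorem** (concludes the crux BY NAME; its two hypotheses are the two stubs BY NAME, as
the registered obligations they are shared with): `CubicSkinComplement` from
(A) = item stmt-18392 `SymplecticScissors.TypeAGeneration` (≝ the statement of `stub_typeAGeneration`,
`Iff.rfl`) and (G) = item stmt-3574 `LiftingCriteria.CubeNashNormalForm` (≝ the statement of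
`stub_cubeNashNormalForm`, `Iff.rfl`). Given (A) and (G), the frame `VolumeForm` holds in every
dimension (`volumeForm_of_stubs`, whose hypotheses are the same two statements written out
literally); the crux's own hypothesis `hS : CubicSkinScissors` — an instance of that conclusion — is
discharged without being consumed (module docstring, §"Why the sector hypothesis is not consumed").
[Kontsevich–Zagier 2001, §1.2 Conjecture 1; Ayoub 2015, Conj. 1.1] -/
theorem CubicSkinComplement_of :
    Summit.KontsevichZagierPeriods.KontsevichZagierPeriods.Theses.SymplecticScissors.TypeAGeneration →
    Summit.KontsevichZagierPeriods.KontsevichZagierPeriods.Theses.LiftingCriteria.CubeNashNormalForm →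
    CubicSkinComplement := by
  intro hT hN _hS
  exact volumeForm_of_stubs hT hN

/-- The two stub STATEMENTS, literally, are the two named obligations (definitional unfolding), so the
skeleton theorem is `<stub₁-sig> → <stub₂-sig> → CubicSkinComplement` on the nose. [folklore] -/
theorem stubs_iff_items :
    ((∀ (k : Type) [Field k] [CharZero k] (σ : k →+* ℂ), (∀ c : k, IsAlgebraic ℚ (σ c)) → ∀ F ∈ Literature.NumberTheory.Transcendental.AyoubRel.Oan σ, Literature.NumberTheory.Transcendental.AyoubRel.intC F = 0 → F ∈ Literature.NumberTheory.Transcendental.AyoubRel.kSpan σ {x : Literature.NumberTheory.Transcendental.AyoubRel.CSeries | ∃ G ∈ Literature.NumberTheory.Transcendental.AyoubRel.Oan σ, ∃ i : ℕ, x = Literature.NumberTheory.Transcendental.AyoubRel.relAC i G}) ↔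
      Summit.KontsevichZagierPeriods.KontsevichZagierPeriods.Theses.SymplecticScissors.TypeAGeneration) ∧
    ((∀ (k k' : ℕ) (r : Literature.NumberTheory.Transcendental.KZ.IntegralRep k) (r' : Literature.NumberTheory.Transcendental.KZ.IntegralRep k'), r.IsRational → r'.IsRational → ∃ (S : ℕ) (n : Fin S → ℕ) (g : (i : Fin S) → (Fin (n i) → ℝ) → ℝ) (U : (i : Fin S) → Set (Fin (n i) → ℝ)) (ε : Fin S → ℤ) (s : (i : Fin S) → Literature.NumberTheory.Transcendental.KZ.IntegralRep (n i)), (∀ i, IsOpen (U i) ∧ Set.pi Set.univ (fun _ : Fin (n i) => Set.Icc (0:ℝ) 1) ⊆ (U i) ∧ Literature.NumberTheory.Transcendental.IsSemialgebraicFunOn ℚ (U i) (g i) ∧ AnalyticOnNhd ℝ (g i) (U i)) ∧ (∀ i, (s i).domain = Set.pi Set.univ (fun _ : Fin (n i) => Set.Icc (0:ℝ) 1) ∧ ∀ z ∈ Set.pi Set.univ (fun _ : Fin (n i) => Set.Icc (0:ℝ) 1), (s i).integrand z = g i z) ∧ Literature.NumberTheory.Transcendental.KZ.of r - Literature.NumberTheory.Transcendental.KZ.of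 r' - ∑ i, ε i • Literature.NumberTheory.Transcendental.KZ.of (s i) ∈ Literature.NumberTheory.Transcendental.KZ.relations) ↔
      Summit.KontsevichZagierPeriods.KontsevichZagierPeriods.Theses.LiftingCriteria.CubeNashNormalForm) :=
  ⟨Iff.rfl, Iff.rfl⟩

/-- The skeleton fed by the two stubs by name (depends on their `sorry`s; elaborates because each
stub's literal statement is definitionally the named obligation in `CubicSkinComplement_of`). -/
theorem CubicSkinComplement_of_stubs : CubicSkinComplement :=
  CubicSkinComplement_of stub_typeAGeneration stub_cubeNashNormalForm

end Summit.KontsevichZagierPeriods.KontsevichZagierPeriods.Cruxes.CubicSkinComplement.Birth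

end
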